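import Mathlib
import Summits.NavierStokesRegularity.NavierStokesRegularity.Theorems.TaoLadderRungTwoFlatBehindApriori
import HarnessLib

/-!
# The BEHIND-ZONE in-hop a-priori bound, SHARP CLOSING LEVEL (referee c88 A-98 / W-25), and the qualitative (B2) cap of the
  landing state (referee c88 W-26) (helper for the K_A♭ parent item stmt-NavierStokesRegularity-22987 `FlatGapCertificatesV2`,
  child 2A `GradedAdiabaticWakeA` of route TaoLadderRungTwoFlat; cell harvest/h2-tao-ladder, p1 g23; LADDER §54–§56)

`…BehindApriori` closes the behind bootstrap at the level `V₀ + Ē_top/μ < V̄`; but `1/μ = O(1/(θ′s)) ≈ 170` at `ε₀ = 10⁻²`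
while inside ONE hop the top input acts only for time `≤ τ₁`: `(1 − e^{−μt})/μ ≤ t ≤ τ₁`. This module re-runs the same
continuous induction with the level `V₀ + Ē_top·τ₁ < V̄` (everything else verbatim), and records the qualitative (B2) cap of
the re-centred landing state, which — like the deep-shell cap of L-55b — is a consequence of the format clause (4.5)
(`PseudoFlowOnShift.apriori_S`) alone.

* `behind_apriori_of_pseudoFlow_sharp`, `behindEnergyClause_hop_of_schedule_sharp` — as in `…BehindApriori` with the sharp level;
* `exists_behindCap_recentre` — `∃ Λ ≥ 0, BehindCapClause K Λ (recentre S τ₁ a)` for every hop flow and every checkpoint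
  (`0 < a`, `τ₁ ∈ [0, τ]`): the (B2) clause propagates through a hop QUALITATIVELY for free; a schedule-level `Λ(n+1)` would
  need a quantitative sup-Grönwall for the quadratic lattice (smallness `‖T♭‖₁Λτ₁ < 1`), which the deep behind zone does not offer.

CROSS-ZONE INPUT (referee c88 W-25, recorded): the interface amplitude `A₁` (`|v_{−K}(t)|` during the hop) sits on a shell
INSIDE the landing block; the level inequality is met in the cell's desk numbers only with the NEAR zone's `O(ε₀)` bound for it,
not with the block-energy bound `√(2V̄)e^{θ′/2}` — `A₁` is an input from `HopTube.near_hop_*`, and the joint near/behind loop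
is assembled one level up.

HONEST FRAMING: inequalities about MODEL-lattice certificate flows (graded mirror table on `S♭`, `m = 2`); the interface
amplitudes and the scalar schedule inequalities are HYPOTHESES; nothing certified; no item closed; nothing about the
Navier–Stokes equations.
-/

noncomputable section

-- the sub-problem namespace repeats the summit name by design (D-0017)
set_option linter.dupNamespace false

namespace Summit.NavierStokesRegularity.NavierStokesRegularity.Theorems.HopTube.R54

open Set Finset Literature.Analysis.FluidPDE Literature.Analysis.FluidPDE.TaoCascade MirrorPulse

section Apriori

variable {ε ε₀ τ κ₂ : ℝ} {S₀ F₀ B₀ : Fin 2 → ℤ → ℝ} {S F : Fin 2 → ℤ → ℝ → ℝ}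

set_option maxHeartbeats 400000 in
/-- **THE BEHIND-ZONE IN-HOP A-PRIORI BOUND (L-54f), SHARP CLOSING LEVEL.** As `behind_apriori_of_pseudoFlow` with the
closing level `V₀ + Ē_top·τ₁ < V̄` (no `1/μ`: inside the hop the input acts for time `≤ τ₁`, `(1−e^{−μt})/μ ≤ t`).
[cite: Tao2016AveragedNS, §4 (4.1), (4.3), (4.5), (4.8), §5 (continuity argument, statement shape); route TaoLadderRungTwoFlat, R54-1 (B1)/(B2), L-54b/L-54f (cell LADDER §54.9), referee c88 A-98] -/
theorem behind_apriori_of_pseudoFlow_sharp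
    (hS : PseudoFlowOnShift shiftSetFlat τ ε₀ (mirrorTable ε ε) 0 κ₂ S₀ F₀ B₀ S F)
    (hε : 0 ≤ ε) (hε₀ : 0 < ε₀) {K : ℕ} {θ' σ τ₁ Aeff A₀ μ Etop V₀ Vbar : ℝ} (hθ : 0 ≤ θ')
    (hθ5 : θ' ≤ 5 * Real.log (1 + ε₀)) (hAeff : 0 < Aeff) (hτ₁ : 0 < τ₁) (hτ₁τ : τ₁ ≤ τ) (hστ : σ * τ₁ = 1)
    (hA₀ : ∀ t ∈ Icc 0 τ₁, |S 0 (-(K : ℤ) + 1) t| ≤ A₀) (hA₀le : A₀ ≤ Aeff)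
    (hEtop : ∀ t ∈ Ioo 0 τ₁,
      Real.exp (θ' * ((((-(K : ℤ)) : ℤ) : ℝ) - (-(K : ℝ) + σ * t))) * |fluxT ε ε₀ S (-(K : ℤ)) t| ≤ Etop)
    (hEtop0 : 0 ≤ Etop)
    (hV₀ : ∀ L : ℕ, coMovingEnergyOn (Finset.Icc (1 - (K : ℤ) - L) (-(K : ℤ))) θ' (-(K : ℝ)) S 0 ≤ V₀)
    (hμ : 0 < μ) (hμle : μ ≤ σ * θ' - 2 * (1 + ε) * Aeff * Real.sinh (θ' / 2))
    (hVbar : V₀ + Etop * τ₁ < Vbar) (hclose : Real.sqrt (2 * Vbar) * Real.exp (θ' / 2) ≤ Aeff) :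
    ∀ t ∈ Icc 0 τ₁, ∀ n : ℤ, n ≤ -(K : ℤ) →
      clock ε₀ n * |S 1 n t| ≤ Aeff ∧ clock ε₀ n * |S 0 (n + 1) t| ≤ Aeff := by
  have hσ : 0 < σ := pos_of_mul_pos_left (by rw [hστ]; exact one_pos) hτ₁.le
  have hε₀' : (-1 : ℝ) ≤ ε₀ := by linarith
  have hV₀0 : 0 ≤ V₀ := (coMovingEnergyOn_nonneg _ _ _ _ _).trans (hV₀ 0)
  -- the flow's own qualitative a-priori bound `Λ` (format clause (4.5)) on `[0, τ]`
  obtain ⟨M, hM⟩ := hS.apriori_S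
  have hΛ : ∀ t ∈ Icc 0 τ₁, ∀ (i : Fin 2) (k : ℤ), |S i k t| ≤ max M 0 := by
    intro t ht i k
    have ht' : t ∈ Icc 0 τ := ⟨ht.1, ht.2.trans hτ₁τ⟩
    have h1 := hM t ht' i k
    have hp : 0 < (1 + ε₀) ^ ((10 : ℝ) * k) := Real.rpow_pos_of_pos (by linarith) _
    have h2 : |S i k t| ≤ (1 + (1 + ε₀) ^ ((10 : ℝ) * k)) * |S i k t| :=
      le_mul_of_one_le_left (abs_nonneg _) (by linarith)
    exact (h2.trans h1).trans (le_max_left _ _)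
  set Λ : ℝ := max M 0 with hΛdef
  have hΛ0 : 0 ≤ Λ := le_max_right _ _
  -- the gap and the deep threshold
  set η' : ℝ := (Vbar - (V₀ + Etop * τ₁)) / 2 with hη'def
  have hη'0 : 0 < η' := by rw [hη'def]; linarith
  obtain ⟨L₀, hL₀⟩ := clock_bottom_eventually_le hε₀ K
    (min (Aeff / (Λ + 1)) (η' / τ₁ / ((1 + ε) * Λ ^ 3 + 1))) (lt_min (by positivity) (by positivity))
  -- deep shells: small clocks
  have hdeep : ∀ m : ℤ, m ≤ -(K : ℤ) - L₀ - 1 →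
      clock ε₀ m ≤ min (Aeff / (Λ + 1)) (η' / τ₁ / ((1 + ε) * Λ ^ 3 + 1)) := by
    intro m hm
    obtain ⟨L, hL⟩ : ∃ L : ℕ, (L : ℤ) = -(K : ℤ) - m := ⟨(-(K : ℤ) - m).toNat, Int.toNat_of_nonneg (by omega)⟩
    have h := hL₀ L (by omega)
    have e : (1 - (K : ℤ) - L - 1) = m := by omega
    rwa [e] at h
  have hdeepA : ∀ m : ℤ, m ≤ -(K : ℤ) - L₀ - 1 → ∀ t ∈ Icc 0 τ₁, ∀ i : Fin 2, ∀ n : ℤ, n ≤ m →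
      clock ε₀ n * |S i m t| ≤ Aeff := by
    intro m hm t ht i n hn
    have hc : clock ε₀ n ≤ Aeff / (Λ + 1) :=
      ((clock_mono hε₀.le hn).trans (hdeep m hm)).trans (min_le_left _ _)
    have hc0 : 0 ≤ clock ε₀ n := clock_nonneg hε₀' _
    calc clock ε₀ n * |S i m t| ≤ Aeff / (Λ + 1) * Λ := mul_le_mul hc (hΛ t ht i m) (abs_nonneg _) (by positivity)
      _ ≤ Aeff := by
          rw [div_mul_eq_mul_div, div_le_iff₀ (by positivity)]
          nlinarith
  -- the one deep block `L⋆ = L₀ + 1`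
  set Lstar : ℕ := L₀ + 1 with hLstar
  have hL1 : 1 ≤ Lstar := by omega
  -- energy level `≤ V̄` on the block `L⋆` at time `t` ⇒ clock-weighted amplitude `≤ A_eff` on EVERY behind bond at time `t`
  have hamp : ∀ t ∈ Icc 0 τ₁,
      coMovingEnergyOn (Finset.Icc (1 - (K : ℤ) - Lstar) (-(K : ℤ))) θ' (-(K : ℝ) + σ * t) S t ≤ Vbar →
        ∀ n : ℤ, n ≤ -(K : ℤ) → clock ε₀ n * |S 1 n t| ≤ Aeff ∧ clock ε₀ n * |S 0 (n + 1) t| ≤ Aeff := by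
    intro t ht hV n hn
    have hσt1 : σ * t ≤ 1 := by nlinarith [ht.2]
    have hblock : ∀ (i : Fin 2) (k : ℤ), k ∈ Finset.Icc (1 - (K : ℤ) - Lstar) (-(K : ℤ)) → ∀ n' : ℤ, n' ≤ k →
        clock ε₀ n' * |S i k t| ≤ Aeff := fun i k hk n' hn' =>
      (clockWeighted_le_of_blockEnergy_le hε₀.le hθ hθ5 hσt1 hV i hk hn').trans hclose
    constructor
    · -- species 1 at shell `n`
      by_cases hcase : 1 - (K : ℤ) - Lstar ≤ n
      · exact hblock 1 n (Finset.mem_Icc.mpr ⟨hcase, hn⟩) n le_rfl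
      · exact hdeepA n (by omega) t ht 1 n le_rfl
    · -- species 0 at shell `n + 1`
      rcases eq_or_lt_of_le hn with heq | hlt
      · -- the core's bottom carrier
        rw [heq]
        have hc1 : clock ε₀ (-(K : ℤ)) ≤ 1 := by
          have h := clock_mono hε₀.le (show (-(K : ℤ)) ≤ 0 by omega)
          have h0 : clock ε₀ 0 = 1 := by unfold clock; simp
          rwa [h0] at h
        have hc0 : 0 ≤ clock ε₀ (-(K : ℤ)) := clock_nonneg hε₀' _
        calc clock ε₀ (-(K : ℤ)) * |S 0 (-(K : ℤ) + 1) t| ≤ 1 * A₀ :=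
              mul_le_mul hc1 (hA₀ t ht) (abs_nonneg _) zero_le_one
          _ ≤ Aeff := by linarith
      · by_cases hcase : 1 - (K : ℤ) - Lstar ≤ n + 1
        · exact hblock 0 (n + 1) (Finset.mem_Icc.mpr ⟨hcase, by omega⟩) n (by omega)
        · exact hdeepA (n + 1) (by omega) t ht 0 n (by omega)
  -- continuous induction on the block energy of `L⋆`
  have haP : (1 - (K : ℤ) - Lstar) ≤ -(K : ℤ) := by omega
  have hcont : ContinuousOn
      (fun t => coMovingEnergyOn (Finset.Icc (1 - (K : ℤ) - Lstar) (-(K : ℤ))) θ' (-(K : ℝ) + σ * t) S t)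
      (Icc 0 τ₁) :=
    continuousOn_coMovingEnergyOn _ fun i n _ =>
      (QuadPolar.continuousOn_of_pseudoFlowOnShift hS i n).mono (Icc_subset_Icc le_rfl hτ₁τ)
  have h0 : coMovingEnergyOn (Finset.Icc (1 - (K : ℤ) - Lstar) (-(K : ℤ))) θ' (-(K : ℝ) + σ * 0) S 0
      ≤ V₀ + Etop * τ₁ + η' := by
    rw [mul_zero, add_zero]
    have := hV₀ Lstar
    have : 0 ≤ Etop * τ₁ := by positivity
    linarith
  have hba : V₀ + Etop * τ₁ + η' < Vbar := by rw [hη'def]; linarith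
  have key := Bootstrap.Icc_induction (T := τ₁) (a := Vbar) (b := V₀ + Etop * τ₁ + η') hτ₁.le hcont hba h0 ?_
  · -- conclusion
    intro t ht n hn
    exact hamp t ht ((key t ht).trans hba.le) n hn
  · -- the step: energies `≤ V̄` on `[0, t]` ⇒ rate valid on `(0, t)` ⇒ transport ⇒ energy `≤ b` at `t`
    intro t ht hpast
    have hbd : ∀ s ∈ Ioo 0 t, ∀ n ∈ Finset.Icc (1 - (K : ℤ) - Lstar - 1) (-(K : ℤ)),
        clock ε₀ n * |S 1 n s| ≤ Aeff ∧ clock ε₀ n * |S 0 (n + 1) s| ≤ Aeff := by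
      intro s hs n hn
      have hs' : s ∈ Icc 0 τ₁ := ⟨hs.1.le, hs.2.le.trans ht.2⟩
      exact hamp s hs' (hpast s ⟨hs.1.le, hs.2.le⟩) n (Finset.mem_Icc.mp hn).2
    have hE : ∀ s ∈ Ioo 0 t,
        Real.exp (θ' * ((((1 - (K : ℤ) - Lstar : ℤ)) : ℝ) - (-(K : ℝ) + σ * s)))
            * |fluxT ε ε₀ S (1 - (K : ℤ) - Lstar - 1) s|
          + Real.exp (θ' * ((((-(K : ℤ)) : ℤ) : ℝ) - (-(K : ℝ) + σ * s))) * |fluxT ε ε₀ S (-(K : ℤ)) s|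
          ≤ η' / τ₁ + Etop := by
      intro s hs
      have hs' : s ∈ Icc 0 τ₁ := ⟨hs.1.le, hs.2.le.trans ht.2⟩
      have hσs : 0 ≤ σ * s := (mul_pos hσ hs.1).le
      have hbot := weighted_bottomFlux_le (θ' := θ') (σ := σ) (K := K) hε hε₀' hθ hL1 S hσs hΛ0
        (hΛ s hs' 1 _) (hΛ s hs' 0 _)
      have hcl : clock ε₀ (1 - (K : ℤ) - Lstar - 1) ≤ η' / τ₁ / ((1 + ε) * Λ ^ 3 + 1) :=
        (hdeep _ (by omega)).trans (min_le_right _ _)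
      have hq0 : 0 < η' / τ₁ := div_pos hη'0 hτ₁
      have hbot' : (1 + ε) * Λ ^ 3 * clock ε₀ (1 - (K : ℤ) - Lstar - 1) ≤ η' / τ₁ := by
        calc (1 + ε) * Λ ^ 3 * clock ε₀ (1 - (K : ℤ) - Lstar - 1)
            ≤ (1 + ε) * Λ ^ 3 * (η' / τ₁ / ((1 + ε) * Λ ^ 3 + 1)) := mul_le_mul_of_nonneg_left hcl (by positivity)
          _ ≤ η' / τ₁ := by
              rw [← mul_div_assoc, div_le_iff₀ (by positivity)]
              nlinarith [hq0]
      have htop := hEtop s ⟨hs.1, hs.2.trans_le ht.2⟩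
      linarith
    have htr := coMovingEnergyOn_transport_of_pseudoFlow (θ := θ') (σ := σ) (n₀ := -(K : ℝ)) hS hε hε₀' hθ
      hAeff.le haP le_rfl ht.1 (ht.2.trans hτ₁τ) hbd hE hμ hμle
    rw [sub_zero, mul_zero, add_zero] at htr
    have he1 : Real.exp (-μ * t) ≤ 1 := by rw [Real.exp_le_one_iff]; nlinarith [ht.1]
    have he0 : 0 ≤ Real.exp (-μ * t) := (Real.exp_pos _).le
    have hf0 : 0 ≤ coMovingEnergyOn (Finset.Icc (1 - (K : ℤ) - Lstar) (-(K : ℤ))) θ' (-(K : ℝ)) S 0 :=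
      coMovingEnergyOn_nonneg _ _ _ _ _
    have hf0' := hV₀ Lstar
    have hq0 : 0 ≤ η' / τ₁ + Etop := by positivity
    -- `(1 − e^{−μt})/μ ≤ t ≤ τ₁` (referee c88 A-98: no `1/μ` in the closing level)
    have hexp : (1 - Real.exp (-μ * t)) / μ ≤ t := by
      rw [div_le_iff₀ hμ]
      have := Real.add_one_le_exp (-μ * t)
      nlinarith
    have hI : (η' / τ₁ + Etop) * (1 - Real.exp (-μ * t)) / μ ≤ (η' / τ₁ + Etop) * τ₁ := by
      rw [mul_div_assoc]
      exact mul_le_mul_of_nonneg_left (hexp.trans ht.2) hq0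
    have hI' : (η' / τ₁ + Etop) * τ₁ = η' + Etop * τ₁ := by field_simp
    calc coMovingEnergyOn (Finset.Icc (1 - (K : ℤ) - Lstar) (-(K : ℤ))) θ' (-(K : ℝ) + σ * t) S t
        ≤ Real.exp (-μ * t) * coMovingEnergyOn (Finset.Icc (1 - (K : ℤ) - Lstar) (-(K : ℤ))) θ' (-(K : ℝ)) S 0
            + (η' / τ₁ + Etop) * (1 - Real.exp (-μ * t)) / μ := htr
      _ ≤ 1 * V₀ + (η' / τ₁ + Etop) * τ₁ := add_le_add (mul_le_mul he1 hf0' hf0 zero_le_one) hI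
      _ = V₀ + Etop * τ₁ + η' := by rw [hI']; ring

/-- **THE BEHIND HOP CLOSED MODULO THE NAMED SCHEDULE HYPOTHESES, SHARP CLOSING LEVEL** (`… + Ē_top·τ₁ < V̄`). Along one exact graded window flow (`0 < ε₀`, slow exponent
`0 < θ′ ≤ 5·log(1+ε₀)`, `στ₁ = 1`): the (B1) clause `BehindEnergyClause K θ′ (W n) z` of the tube state, its bottom-shell
amplitude `a_K`, the kick `|S₀ − z| ≤ r_k` behind, the interface amplitudes `|v_{−K}| ≤ A₁` (near zone) and `|a_{1−K}| ≤ A₀`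
(core bottom) during the hop, a rate level `A_eff ≥ A₀` with `0 < μ ≤ σθ′ − 2(1+ε)A_eff sinh(θ′/2)`, and the scalar inequalities
(closing level) `V₀ + Ē_top·τ₁ < V̄`, (closing gauge) `√(2V̄)e^{θ′/2} ≤ A_eff`, (budget) `e^{−μτ₁}V₀ + Ē_top(1−e^{−μτ₁})/μ ≤ a²W′`
with `V₀ := (√(W n + a_K²) + r_k/√(1−e^{−θ′}))²`, `Ē_top := A₁A₀(A₁+εA₀)` give `BehindEnergyClause K θ′ W′ (recentre S τ₁ a)`.
[cite: Tao2016AveragedNS, §4 (4.1), (4.3), (4.5), (4.8), §6.3–6.4 (statement shape); route TaoLadderRungTwoFlat, `HopTube.TubeStepBehind` under R54-1 (cell LADDER §54–§55)] -/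
theorem behindEnergyClause_hop_of_schedule_sharp
    (hS : PseudoFlowOnShift shiftSetFlat τ ε₀ (mirrorTable ε ε) 0 κ₂ S₀ F₀ B₀ S F)
    (hε : 0 ≤ ε) (hε₀ : 0 < ε₀) {K : ℕ} {θ' σ τ₁ a Aeff A₁ A₀ μ Wn aK rk Vbar W' : ℝ} {z : Fin 2 → ℤ → ℝ}
    (hθ : 0 < θ') (hθ5 : θ' ≤ 5 * Real.log (1 + ε₀)) (hAeff : 0 < Aeff) (hτ₁ : 0 < τ₁) (hτ₁τ : τ₁ ≤ τ)
    (hστ : σ * τ₁ = 1) (ha : 0 < a)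
    (hW : BehindEnergyClause K θ' Wn z) (hWn : 0 ≤ Wn) (haK : ∀ i, |z i (-(K : ℤ))| ≤ aK)
    (hkick : ∀ (i : Fin 2) (k : ℤ), k ≤ -(K : ℤ) → |S₀ i k - z i k| ≤ rk) (hrk : 0 ≤ rk)
    (hA₁ : ∀ t ∈ Ioo 0 τ₁, |S 1 (-(K : ℤ)) t| ≤ A₁) (hA₀ : ∀ t ∈ Icc 0 τ₁, |S 0 (-(K : ℤ) + 1) t| ≤ A₀)
    (hA₀le : A₀ ≤ Aeff) (hμ : 0 < μ) (hμle : μ ≤ σ * θ' - 2 * (1 + ε) * Aeff * Real.sinh (θ' / 2))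
    (hlevel : (Real.sqrt (Wn + aK ^ 2) + rk / Real.sqrt (1 - Real.exp (-θ'))) ^ 2
        + A₁ * A₀ * (A₁ + ε * A₀) * τ₁ < Vbar)
    (hclose : Real.sqrt (2 * Vbar) * Real.exp (θ' / 2) ≤ Aeff)
    (hbudget : Real.exp (-μ * τ₁) * (Real.sqrt (Wn + aK ^ 2) + rk / Real.sqrt (1 - Real.exp (-θ'))) ^ 2
        + A₁ * A₀ * (A₁ + ε * A₀) * (1 - Real.exp (-μ * τ₁)) / μ ≤ a ^ 2 * W') :
    BehindEnergyClause K θ' W' (recentre S τ₁ a) := by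
  have hσ : 0 < σ := pos_of_mul_pos_left (by rw [hστ]; exact one_pos) hτ₁.le
  have hV₀ : ∀ L : ℕ, coMovingEnergyOn (Finset.Icc (1 - (K : ℤ) - L) (-(K : ℤ))) θ' (-(K : ℝ)) S 0
      ≤ (Real.sqrt (Wn + aK ^ 2) + rk / Real.sqrt (1 - Real.exp (-θ'))) ^ 2 := fun L =>
    initial_blockEnergy_le_additive hS.init_S hθ hW hWn haK (fun i k hk => hkick i k (Finset.mem_Icc.mp hk).2) hrk
  have hEtop : ∀ t ∈ Ioo 0 τ₁,
      Real.exp (θ' * ((((-(K : ℤ)) : ℤ) : ℝ) - (-(K : ℝ) + σ * t))) * |fluxT ε ε₀ S (-(K : ℤ)) t|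
        ≤ A₁ * A₀ * (A₁ + ε * A₀) := fun t ht =>
    weighted_topFlux_le hε hε₀.le hθ.le K S (mul_pos hσ ht.1).le (hA₁ t ht) (hA₀ t ⟨ht.1.le, ht.2.le⟩)
  have hEtop0 : 0 ≤ A₁ * A₀ * (A₁ + ε * A₀) := by
    have ht : τ₁ / 2 ∈ Ioo 0 τ₁ := ⟨by linarith, by linarith⟩
    exact le_trans (by positivity) (hEtop (τ₁ / 2) ht)
  have hbd := behind_apriori_of_pseudoFlow_sharp hS hε hε₀ hθ.le hθ5 hAeff hτ₁ hτ₁τ hστ hA₀ hA₀le hEtop hEtop0 hV₀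
    hμ hμle hlevel hclose
  exact behindEnergyClause_hop_topInput hS hε hε₀ hθ.le hAeff.le hτ₁ hτ₁τ hστ ha
    (fun t ht n hn => hbd t ⟨ht.1.le, ht.2.le⟩ n hn) hEtop hV₀ hbudget hμ hμle

/-- **(B2) through a hop, qualitatively (referee c88 W-26).** Every hop flow is uniformly bounded over ALL shells on
`[0, τ]` by the format clause (4.5); hence the re-centred landing state at any checkpoint `(τ₁, a)`, `τ₁ ∈ [0, τ]`, `a > 0`,
satisfies `BehindCapClause K Λ` for SOME `Λ ≥ 0` (flow-dependent, size unknown and immaterial).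
[cite: Tao2016AveragedNS, §4 (4.5), §6.3–6.4 (statement shape); route TaoLadderRungTwoFlat, R54-1 (B2) (cell LADDER §54.9)] -/
theorem exists_behindCap_recentre
    (hS : PseudoFlowOnShift shiftSetFlat τ ε₀ (mirrorTable ε ε) 0 κ₂ S₀ F₀ B₀ S F) (hε₀ : -1 ≤ ε₀)
    {τ₁ a : ℝ} (hτ₁ : τ₁ ∈ Icc 0 τ) (ha : 0 < a) (K : ℕ) :
    ∃ Λ : ℝ, 0 ≤ Λ ∧ BehindCapClause K Λ (recentre S τ₁ a) := by
  obtain ⟨M, hM⟩ := hS.apriori_S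
  refine ⟨max M 0 / a, by positivity, fun i k _ => ?_⟩
  have h1 := hM τ₁ hτ₁ i (1 + k)
  have hp : 0 ≤ (1 + ε₀) ^ ((10 : ℝ) * ((1 + k : ℤ) : ℝ)) := Real.rpow_nonneg (by linarith) _
  have h2 : |S i (1 + k) τ₁| ≤ (1 + (1 + ε₀) ^ ((10 : ℝ) * ((1 + k : ℤ) : ℝ))) * |S i (1 + k) τ₁| :=
    le_mul_of_one_le_left (abs_nonneg _) (by linarith)
  have h3 : |S i (1 + k) τ₁| ≤ max M 0 := (h2.trans h1).trans (le_max_left _ _)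
  unfold recentre
  rw [abs_div, abs_of_pos ha]
  exact div_le_div_of_nonneg_right h3 ha.le

end Apriori

end Summit.NavierStokesRegularity.NavierStokesRegularity.Theorems.HopTube.R54

end
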